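import Literature.Geometry.Kaehler.ComplexTorusAbelianThreefoldImaginaryQuadraticDerivedHodgeLieAlgebraSimple
import Literature.Geometry.Kaehler.ComplexTorusHodgeLieAlgebraRatProductNoCommonFactor
import Literature.Geometry.Kaehler.ComplexTorusHodgeGroupTorusIffCM
import Literature.Algebra.Lie.GoursatPerfectSolvable
import HarnessLib

/-!
# Moonen–Zarhin 1999 §5 (5.8) and Thm. (0.2) (4) for `T × S`: a simple abelian threefold `T` of type IV(1,1) splits off every
# complex torus `S` whose Hodge Lie algebra `𝒜(S)` is semisimple of dimension `< 8` (Lemma (3.4) through the common-quotient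
# form of Goursat's lemma); hence `Hg(T × S) = Hg(T) × Hg(S)` and condition (D) for `T` of type IV(1,1) and `S` a simple surface of
# type I(2) ∕ II(1), and THE `T × S` DISPATCH WITH THE LAST RESIDUAL: (D) for all simple `T`, `S` not both of CM type

Layer `Literature/Geometry/Kaehler`, namespace `Literature.Geometry.Kaehler.ComplexTorus`; lane `lit-hodgefound` (Track 2
foundations library), Layer A3∕A4; prover seat `lit-hodgefound-p17`, generation 55, self-proposed row g55-#8 (the residual
sub-case «`T` of type IV(1,1) × `S` of type I(2) ∕ II(1)» of ✔ g55-#5∕#6, on ✔ g55-#7's `𝒟𝒜(T)` simple).  THEOREMS ONLY (no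
definition, no instance, no notation, no named fact; D-0026 net debt `0`).

## Sources, VERBATIM (held `paper:arxiv-math_9901113`; locators are page ∕ line of the materialisation)

B. J. J. Moonen, Yu. G. Zarhin [MoonenZarhin1999LowDim], Math. Ann. **315** (1999):
* §5 (5.8) (p0010 L3–L9): «Suppose `(d₁,d₂) = (2,3)`. If `X₁` is simple then Lemma (3.4) gives `Hg(X) = Hg(X₁) × Hg(X₂)`. If
  `X₁` is not simple then it is isogenous to a product of two elliptic curves …»; §3 Lemma (3.4) (p0006 L133–L138) and its proof
  (p0007 L1–L8: «There is a quotient `𝔤₁'` of `𝔤₁` such that `𝔥𝔤(Y) = 𝔤₁' ⊕ 𝔤₃` … we obtain an isomorphism `𝔥𝔤(X₂) ⥲ 𝔤₃`»);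
  §3 (3.1) (p0006 L25–L45: «`𝔥𝔤(X₁) ≅ 𝔤₁ ⊕ 𝔤₃`, `𝔥𝔤(X₂) ≅ 𝔤₂ ⊕ 𝔤₃`»); §2 (2.2) `g = 2` (p0005 L52–L78: Types I(2) «`Hg(X) =
  Res_{F/ℚ} SL_2`», II(1)); (2.3) `g = 3` Type IV(1,1), IV(3,1) (p0005 L101–L106: «`X` is of CM-type»); Thm. (0.2) (4) (p0002 L1–L8);
  (5.10) (p0010 L18–L45).
* B. B. Gordon [Gordon1997], §2.16 Proposition (Goursat: «`𝔰` is the graph of an isomorphism»).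
* N. Bourbaki [Bourbaki1989LieGroups13], Ch. I §6 no. 4 Prop. 5 (reductive: `𝔤 = 𝔷 × 𝒟𝔤`), §1 no. 5 Prop. 4.
* H. Lange [Lange2023AbelianVarietiesComplex], §2.6.1 Proposition (Albert types at `g = 2`).

## What is proved, and how

* §1 `IsSimple.isSemisimple_hodgeGroupLieRat_of_isTotallyReal` (simple polarised torus with totally real centre ⟹ `𝒜` semisimple:
  no type IV), `IsSimple.isSemisimple_hodgeGroupLieRat_of_not_hodgeGroup_comm_of_finrank_eq_two` and
  `IsSimple.finrank_hodgeGroupLieRat_le_six_of_endAlgRat_ne_bot_of_finrank_eq_two` (simple surfaces: types I(2), II(1) have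
  semisimple `𝒜` of dimension `6`, `3`; type IV is CM), `IsSimple.hodgeGroup_comm_of_finrank_centerField_eq_six_of_finrank_eq_three`
  (type IV(3,1) is CM).
* §2 **`IsSimple.hodgeGroupC_prod_eq_blockDiagProd_of_finrank_centerField_eq_two_of_isSemisimple_of_finrank_lt`** — LEMMA (3.4) for
  `T` of type IV(1,1) and ANY complex torus `S` with `𝒜(S)` semisimple of dimension `< 8`.  PROOF (the common-quotient form of
  (3.1), the tree's `exists_ne_top_nonempty_lieEquiv_hodgeGroupLieRat_quotient_of_ne`): non-split gives non-zero quotients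
  `𝒜(T)/N₁ ≅ 𝒜(S)/N₂` over `ℚ`.  `𝒜(T) = 𝔷 ⊕ 𝒟𝒜(T)` with `𝒟𝒜(T)` simple of dimension `≥ 8` (✔ g55-#7) and `dim 𝔷 < 2`, so every
  ideal `N₁` contains `𝒟𝒜(T)` or is central (file-local `derived_le_or_le_center`), and `dim 𝒜(T)/N₁ ∈ {0, 1, 8, 9}`; a non-zero
  quotient of the perfect `𝒜(S)` is not abelian, so has dimension in `[2, 7]` — contradiction.
* §3 (5.8): **`IsSimple.forall_divisorClasses_powPeriod_prod_eq_hodgeClasses_of_finrank_centerField_eq_two_of_finrank_eq_three_two`**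
  (`T` of type IV(1,1), `S` ANY simple polarised surface ⟹ (D) for `T × S`: `S` CM by ✔ g55-#5, `End⁰(S) = ℚ` by ✔ g55-#3, else §2),
  and THE DISPATCH WITH THE LAST RESIDUAL **`IsSimple.forall_divisorClasses_powPeriod_prod_eq_hodgeClasses_of_finrank_eq_three_two_of_not_and`**:
  `T`, `S` simple polarised of dimensions `3`, `2`, NOT BOTH OF CM TYPE ⟹ `ℬ•((T × S)ⁿ) = 𝒟•((T × S)ⁿ)` for all `n` — the only
  class not covered is `T` CM × `S` CM ((5.10) with both `Y₁`, `Y₂` of CM type, the Galois-group comparison; -- TODO(general form));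
  isogeny and «`Hg = Sp_D`» forms.
-/

noncomputable section

open Matrix Module Function NumberField LieAlgebra

open scoped MatrixGroups

namespace Literature.Geometry.Kaehler

namespace ComplexTorus

open Literature.Algebra.Lie (GoursatPerfectSolvable.derivedSeries_one_eq_top_of_isSemisimple
  GoursatPerfectSolvable.derivedSeries_one_le_of_isLieAbelian_quotient)
open Literature.NumberTheory.Automorphic (IsTorusSubgroup)

/-! ### §0 Plumbing (file-local): two Lie-algebra lemmas -/

section Plumbing

variable {K : Type*} [Field K] {L : Type*} [LieRing L] [LieAlgebra K L]

/-- **In a Lie algebra whose derived algebra is simple, every ideal contains the derived algebra or is central** (`N ∩ 𝒟L` is an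
ideal of the simple `𝒟L`; if it is `0` then `[L, N] ⊆ N ∩ 𝒟L = 0`). [cite: Bourbaki1989LieGroups13, Ch. I §6 no. 4 Prop. 5 and §1 no. 5 Prop. 4] -/
private theorem derived_le_or_le_center₅₈ [LieAlgebra.IsSimple K (derivedSeries K L 1)] (N : LieIdeal K L) :
    derivedSeries K L 1 ≤ N ∨ N ≤ LieAlgebra.center K L := by
  rcases LieAlgebra.IsSimple.eq_bot_or_eq_top (LieIdeal.comap (derivedSeries K L 1).incl N) with h | h
  · right
    intro n hn
    rw [LieModule.mem_maxTrivSubmodule]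
    intro x
    have hD : ⁅x, n⁆ ∈ derivedSeries K L 1 := by
      rw [derivedSeries_def, derivedSeriesOfIdeal_succ, derivedSeriesOfIdeal_zero]
      exact LieSubmodule.lie_mem_lie (LieSubmodule.mem_top x) (LieSubmodule.mem_top n)
    have hN : ⁅x, n⁆ ∈ N := lie_mem_right K L N x n hn
    have hmem : (⟨⁅x, n⁆, hD⟩ : derivedSeries K L 1) ∈ LieIdeal.comap (derivedSeries K L 1).incl N := by
      rw [LieIdeal.mem_comap]
      exact hN
    rw [h, LieSubmodule.mem_bot] at hmem
    exact congrArg Subtype.val hmem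
  · left
    intro x hx
    have hmem : (⟨x, hx⟩ : derivedSeries K L 1) ∈ LieIdeal.comap (derivedSeries K L 1).incl N := by
      rw [h]; exact LieSubmodule.mem_top _
    rw [LieIdeal.mem_comap] at hmem
    exact hmem

/-- **A Lie algebra of dimension `≤ 1` is abelian.** [folklore] -/
private theorem isLieAbelian_of_finrank_le_one₅₈ [FiniteDimensional K L] (h : finrank K L ≤ 1) : IsLieAbelian L := by
  rcases Nat.le_one_iff_eq_zero_or_eq_one.1 h with h0 | h1
  · haveI : Subsingleton L := finrank_zero_iff.1 h0
    exact ⟨fun x m ↦ Subsingleton.elim _ _⟩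
  · obtain ⟨v, hv⟩ := finrank_eq_one_iff'.1 h1
    refine ⟨fun x m ↦ ?_⟩
    obtain ⟨a, ha⟩ := hv.2 x
    obtain ⟨b, hb⟩ := hv.2 m
    rw [← ha, ← hb, smul_lie, lie_smul, lie_self, smul_zero, smul_zero]

end Plumbing

/-! ## §1 Semisimplicity and dimension of `𝒜` for simple factors with totally real centre; type IV(3,1) is CM -/

section Semisimple

variable {κ : Type} [Fintype κ] [DecidableEq κ] [Nonempty κ] {E : Type} [NormedAddCommGroup E] [NormedSpace ℂ E]
  [FiniteDimensional ℂ E] {Ψ : (κ → ℝ) ≃L[ℝ] E} {η : E [⋀^Fin 2]→L[ℝ] ℝ}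

omit [FiniteDimensional ℂ E] in
/-- **A simple polarised complex torus whose endomorphism algebra has TOTALLY REAL centre has SEMISIMPLE `𝒜`** («If `X` has no
factors of Type IV then `Hg(X)` is semi-simple»: the Rosati involution is trivial on the centre).
[cite: MoonenZarhin1999LowDim, §1 (p0002 L134–L136)] [cite: Lange2023AbelianVarietiesComplex, §2.6.1 (p. 137) and §7.2.4 Exercise (2)] -/
theorem IsSimple.isSemisimple_hodgeGroupLieRat_of_isTotallyReal (hX : IsSimple Ψ) [IsTotallyReal (centerField Ψ hX)]
    (hη : IsRiemannForm Ψ η) : LieAlgebra.IsSemisimple ℚ (hodgeGroupLieRat Ψ) := by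
  obtain ⟨G, hG⟩ := hη.exists_ratMatrix_latticeGram
  have hval := (hX.forall_rosati_val_eq_iff_isTotallyReal hη hG).2 ‹_›
  exact hη.isSemisimple_hodgeGroupLieRat_of_forall_rosati_eq hG fun B hB hc ↦ by
    obtain ⟨z, rfl⟩ := centerField.exists_val_eq Ψ hX hB hc
    exact hval z

/-- **Simple surfaces with non-commutative Hodge group have semisimple `𝒜`** (types I(1), I(2), II(1): totally real centre; type
III does not occur at `g = 2`; type IV at `g = 2` is CM). [cite: MoonenZarhin1999LowDim, §2 (2.2) `g = 2` (p0005 L52–L78)]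
[cite: Lange2023AbelianVarietiesComplex, §2.6.1 Proposition] -/
theorem IsSimple.isSemisimple_hodgeGroupLieRat_of_not_hodgeGroup_comm_of_finrank_eq_two (hX : IsSimple Ψ)
    (hη : IsRiemannForm Ψ η) (h2 : finrank ℂ E = 2) (hnc : ¬ ∀ M ∈ hodgeGroup Ψ, ∀ N ∈ hodgeGroup Ψ, M * N = N * M) :
    LieAlgebra.IsSemisimple ℚ (hodgeGroupLieRat Ψ) := by
  obtain ⟨G, hG⟩ := hη.exists_ratMatrix_latticeGram
  rcases hX.isAlbertType_of_finrank_le_seven hη hG (by omega) with hI | hII | hIII | hIV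
  · haveI : IsTotallyReal (centerField Ψ hX) := hI.isTotallyReal
    exact hX.isSemisimple_hodgeGroupLieRat_of_isTotallyReal hη
  · haveI : IsTotallyReal (centerField Ψ hX) := hII.isTotallyReal
    exact hX.isSemisimple_hodgeGroupLieRat_of_isTotallyReal hη
  · exact absurd hIII (hX.not_isAlbertTypeIII_of_finrank_eq_two hη hG h2)
  · exact absurd (IsAbelianVariety.hodgeGroup_comm_of_finrank_hodgeGroupLie_le_two ⟨η, hη⟩
      (hX.finrank_hodgeGroupLie_eq_two_of_isAlbertTypeIV_of_finrank_eq_two hη hG hIV h2).le) hnc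

/-- **`dim_ℚ 𝒜(S) ≤ 6` for a simple surface with `End⁰(S) ≠ ℚ`** (`dim Hg(S) ∈ {2, 3, 6, 10}` and `10` is `End⁰ = ℚ`).
[cite: MoonenZarhin1999LowDim, §2 (2.2) `g = 2` (p0005 L52–L78)] -/
theorem IsSimple.finrank_hodgeGroupLieRat_le_six_of_endAlgRat_ne_bot_of_finrank_eq_two (hX : IsSimple Ψ)
    (hη : IsRiemannForm Ψ η) (h2 : finrank ℂ E = 2) (hE : endAlgRat Ψ ≠ ⊥) : finrank ℚ (hodgeGroupLieRat Ψ) ≤ 6 := by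
  rw [finrank_hodgeGroupLieRat_eq]
  have hmem := hX.finrank_hodgeGroupLie_mem_four_of_finrank_eq_two hη h2
  have h10 : finrank ℝ (hodgeGroupLie Ψ) ≠ 10 := fun h ↦
    hE ((hη.finrank_hodgeGroupLie_eq_ten_iff_endAlgRat_eq_bot_of_finrank_eq_two h2).1 h)
  simp only [Finset.mem_insert, Finset.mem_singleton] at hmem
  omega

/-- **TYPE IV(3,1) IS CM: `[Z(End⁰ T) : ℚ] = 6` ⟹ `Hg(T)` is commutative** (`MT(T)(ℂ)` is a torus, «`X` is of CM-type»).
[cite: MoonenZarhin1999LowDim, §2 (2.3) `g = 3` Type IV(3,1) and Prop. (2.4) (2) (p0005 L104–L118)] [cite: Gordon1997, §2 Prop. 2.12] -/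
theorem IsSimple.hodgeGroup_comm_of_finrank_centerField_eq_six_of_finrank_eq_three (hX : IsSimple Ψ) (hη : IsRiemannForm Ψ η)
    (h3 : finrank ℂ E = 3) (he : finrank ℚ (centerField Ψ hX) = 6) :
    ∀ M ∈ hodgeGroup Ψ, ∀ N ∈ hodgeGroup Ψ, M * N = N * M := by
  have hMT : IsTorusSubgroup (mumfordTateGroupC Ψ) := by
    rcases (hX.four_cases_of_finrank_eq_three hη h3).2 with ⟨-, h1, -⟩ | ⟨-, h3', -⟩ | ⟨-, h2', -⟩ | ⟨-, -, hT, -⟩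
    · omega
    · omega
    · omega
    · exact hT
  have hHg := (isTorusSubgroup_mumfordTateGroupC_iff_map_toGL_hodgeGroupC Ψ).1 hMT
  exact (hodgeGroup_comm_iff_hodgeGroupC_comm Ψ).2 fun M hM N hN ↦ hodgeGroupC_comm_of_isTorusSubgroup Ψ hHg hM hN

end Semisimple

/-! ## §2 Lemma (3.4) for `T` of type IV(1,1): common quotients of `𝒜(T) = 𝔷 ⊕ 𝒟𝒜(T)` and a semisimple `𝒜(S)` of dimension `< 8` -/

section SplitOff

variable {ι : Type*} [Fintype ι] [DecidableEq ι] {F : Type*} [NormedAddCommGroup F] [NormedSpace ℂ F]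
  (Φ : (ι → ℝ) ≃L[ℝ] F)
  {κ : Type} [Fintype κ] [DecidableEq κ] [Nonempty κ] {E : Type} [NormedAddCommGroup E] [NormedSpace ℂ E]
  [FiniteDimensional ℂ E] {Ψ : (κ → ℝ) ≃L[ℝ] E} {η : E [⋀^Fin 2]→L[ℝ] ℝ}

/-- **MOONEN–ZARHIN LEMMA (3.4) FOR `T` OF TYPE IV(1,1), QUOTIENT FORM: a simple polarised threefold `T` with `[Z(End⁰ T) : ℚ] = 2`
splits off EVERY complex torus `S` whose Hodge Lie algebra `𝒜(S)` is semisimple of dimension `< 8`: `Hg(T × S)(ℂ) =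
Hg(T)(ℂ) × Hg(S)(ℂ)`.**  PROOF: a non-split product has non-zero `ℚ`-isomorphic quotients `𝒜(T)/N₁ ≅ 𝒜(S)/N₂` ((3.1): both are
`≅ 𝔤₃ ≠ 0`); every ideal of `𝒜(T)` contains the simple `𝒟𝒜(T)` (`dim ≥ 8`) or is central (`dim ≤ 1`), so `dim 𝒜(T)/N₁ ∈ {1, 8, 9}`
(`dim 𝒜(T) = 9`); a non-zero quotient of the perfect `𝒜(S)` is non-abelian of dimension `∈ [2, 7]`.
[cite: MoonenZarhin1999LowDim, §3 (3.1) and Lemma (3.4) with proof (p0006 L25–L45, L133 – p0007 L8), §5 (5.8) (p0010 L3–L9)]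
[cite: Gordon1997, §2.16 Proposition] [cite: Bourbaki1989LieGroups13, Ch. I §6 no. 4 Prop. 5] -/
theorem IsSimple.hodgeGroupC_prod_eq_blockDiagProd_of_finrank_centerField_eq_two_of_isSemisimple_of_finrank_lt
    (hT : IsSimple Ψ) (hη : IsRiemannForm Ψ η) (h3 : finrank ℂ E = 3) (he : finrank ℚ (centerField Ψ hT) = 2)
    [LieAlgebra.IsSemisimple ℚ (hodgeGroupLieRat Φ)] (hlt : finrank ℚ (hodgeGroupLieRat Φ) < 8) :
    hodgeGroupC (prodPeriod Ψ Φ) = blockDiagProd (hodgeGroupC Ψ) (hodgeGroupC Φ) := by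
  by_contra hne
  obtain ⟨N₁, N₂, hN₁, hN₂, -, -, ⟨e⟩⟩ := exists_ne_top_nonempty_lieEquiv_hodgeGroupLieRat_quotient_of_ne Ψ Φ hne
  -- dimensions on the `T` side
  haveI := hT.isSimple_derivedSeries_hodgeGroupLieRat_of_finrank_centerField_eq_two_of_finrank_eq_three hη h3 he
  haveI : IsCMField (centerField Ψ hT) := (hT.isCMField_centerField_iff_even_of_finrank_eq_three hη h3).2 (by rw [he]; decide)
  have h9 : finrank ℚ (hodgeGroupLieRat Ψ) = 9 := by
    rw [finrank_hodgeGroupLieRat_eq]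
    exact hT.finrank_hodgeGroupLie_eq_nine_of_finrank_centerField_eq_two_of_finrank_eq_three hη he h3
  have h8 := hT.le_finrank_derivedSeries_hodgeGroupLieRat_of_finrank_centerField_eq_two_of_finrank_eq_three hη h3 he
  have hz : finrank ℚ (LieAlgebra.center ℚ (hodgeGroupLieRat Ψ)) < 2 :=
    lt_of_lt_of_eq (finrank_center_hodgeGroupLieRat_lt_finrank_endAlgRat Ψ)
      (hT.finrank_endAlgRat_eq_two_of_finrank_centerField_eq_two_of_finrank_eq_three h3 he)
  have hq₁ := Submodule.finrank_quotient_add_finrank (LieSubmodule.toSubmodule N₁)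
  have hq₂ := Submodule.finrank_quotient_add_finrank (LieSubmodule.toSubmodule N₂)
  have hN₁' : finrank ℚ (LieSubmodule.toSubmodule N₁) ≤ 1 ∨ 8 ≤ finrank ℚ (LieSubmodule.toSubmodule N₁) := by
    rcases derived_le_or_le_center₅₈ N₁ with h | h
    · exact Or.inr (h8.trans (Submodule.finrank_mono (show LieSubmodule.toSubmodule (derivedSeries ℚ (hodgeGroupLieRat Ψ) 1) ≤
        LieSubmodule.toSubmodule N₁ from h)))
    · refine Or.inl (Nat.lt_succ_iff.1 (lt_of_le_of_lt (Submodule.finrank_mono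
        (show LieSubmodule.toSubmodule N₁ ≤ LieSubmodule.toSubmodule (LieAlgebra.center ℚ (hodgeGroupLieRat Ψ)) from h)) hz))
  -- dimensions on the `S` side: `0 < dim 𝒜(S)/N₂`, and `dim = 1` would make the quotient of the perfect `𝒜(S)` abelian
  have hN₂lt : finrank ℚ (LieSubmodule.toSubmodule N₂) < finrank ℚ (hodgeGroupLieRat Φ) := by
    rw [← finrank_top ℚ (hodgeGroupLieRat Φ)]
    exact Submodule.finrank_lt_finrank_of_lt (lt_top_iff_ne_top.2 fun h ↦ hN₂ ((LieSubmodule.toSubmodule_eq_top N₂).1 h))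
  have hq₂ne : finrank ℚ (hodgeGroupLieRat Φ ⧸ N₂) ≠ 1 := fun h1 ↦ by
    haveI : IsLieAbelian (hodgeGroupLieRat Φ ⧸ N₂) := isLieAbelian_of_finrank_le_one₅₈ h1.le
    have hle := GoursatPerfectSolvable.derivedSeries_one_le_of_isLieAbelian_quotient N₂
    rw [GoursatPerfectSolvable.derivedSeries_one_eq_top_of_isSemisimple, top_le_iff] at hle
    exact hN₂ hle
  have heq := e.toLinearEquiv.finrank_eq
  have hq₁' : finrank ℚ (hodgeGroupLieRat Ψ ⧸ N₁) + finrank ℚ (LieSubmodule.toSubmodule N₁) = 9 := h9 ▸ hq₁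
  have hq₂' : finrank ℚ (hodgeGroupLieRat Φ ⧸ N₂) + finrank ℚ (LieSubmodule.toSubmodule N₂) = finrank ℚ (hodgeGroupLieRat Φ) := hq₂
  omega

variable {Φ} {ω : F [⋀^Fin 2]→L[ℝ] ℝ}

/-- Real points of the same splitting. [cite: MoonenZarhin1999LowDim, §3 Lemma (3.4) and §5 (5.8)] -/
theorem IsSimple.hodgeGroup_prod_eq_of_finrank_centerField_eq_two_of_isSemisimple_of_finrank_lt
    (hT : IsSimple Ψ) (hη : IsRiemannForm Ψ η) (h3 : finrank ℂ E = 3) (he : finrank ℚ (centerField Ψ hT) = 2)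
    [LieAlgebra.IsSemisimple ℚ (hodgeGroupLieRat Φ)] (hlt : finrank ℚ (hodgeGroupLieRat Φ) < 8) :
    hodgeGroup (prodPeriod Ψ Φ) = ((hodgeGroup Ψ).prod (hodgeGroup Φ)).map (blockDiag κ ι) :=
  hodgeGroup_prod_eq_of_hodgeGroupC_prod_eq
    (hT.hodgeGroupC_prod_eq_blockDiagProd_of_finrank_centerField_eq_two_of_isSemisimple_of_finrank_lt Φ hη h3 he hlt)

/-- **(D)-transfer**: `T` of type IV(1,1), `S` with semisimple `𝒜(S)` of dimension `< 8` and (D) ⟹ (D) for `T × S`.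
[cite: MoonenZarhin1999LowDim, Thm. (0.2) (4) (p0002 L1–L8), §5 (5.8), §3 Thm. (3.2) (2)] [cite: Hazama1983, Lemma (3.1)] -/
theorem IsSimple.forall_divisorClasses_powPeriod_prod_eq_hodgeClasses_of_finrank_centerField_eq_two_of_isSemisimple_of_finrank_lt
    (hT : IsSimple Ψ) (hη : IsRiemannForm Ψ η) (h3 : finrank ℂ E = 3) (he : finrank ℚ (centerField Ψ hT) = 2)
    [LieAlgebra.IsSemisimple ℚ (hodgeGroupLieRat Φ)] (hlt : finrank ℚ (hodgeGroupLieRat Φ) < 8)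
    (hS : ∀ k p, divisorClasses (powPeriod Φ k) p = hodgeClasses (powPeriod Φ k) p) :
    ∀ k p, divisorClasses (powPeriod (prodPeriod Ψ Φ) k) p = hodgeClasses (powPeriod (prodPeriod Ψ Φ) k) p :=
  forall_divisorClasses_powPeriod_prod_eq_hodgeClasses_of_hodgeGroupC_prod_eq
    (hT.hodgeGroupC_prod_eq_blockDiagProd_of_finrank_centerField_eq_two_of_isSemisimple_of_finrank_lt Φ hη h3 he hlt)
    (hη.forall_divisorClasses_powPeriod_eq_hodgeClasses_of_finrank_eq_three h3) hS

end SplitOff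

/-! ## §3 (5.8) and the `T × S` dispatch with the last residual -/

section ThreefoldTimesSurface

variable {κ₁ κ₂ : Type} [Fintype κ₁] [DecidableEq κ₁] [Nonempty κ₁] [Fintype κ₂] [DecidableEq κ₂] [Nonempty κ₂]
  {E₁ E₂ : Type} [NormedAddCommGroup E₁] [NormedSpace ℂ E₁] [FiniteDimensional ℂ E₁] [NormedAddCommGroup E₂]
  [NormedSpace ℂ E₂] [FiniteDimensional ℂ E₂] {Ψ₁ : (κ₁ → ℝ) ≃L[ℝ] E₁} {Ψ₂ : (κ₂ → ℝ) ≃L[ℝ] E₂}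
  {η₁ : E₁ [⋀^Fin 2]→L[ℝ] ℝ} {η₂ : E₂ [⋀^Fin 2]→L[ℝ] ℝ}

/-- **MOONEN–ZARHIN (5.8) WITH `X₁` SIMPLE: `T` of type IV(1,1), `S` a simple polarised surface with NON-COMMUTATIVE Hodge group and
`End⁰(S) ≠ ℚ` (types I(2), II(1)) ⟹ `Hg(T × S)(ℂ) = Hg(T)(ℂ) × Hg(S)(ℂ)`** («If `X₁` is simple then Lemma (3.4) gives
`Hg(X) = Hg(X₁) × Hg(X₂)`»). [cite: MoonenZarhin1999LowDim, §5 (5.8) (p0010 L3–L9), §3 Lemma (3.4), §2 (2.2) `g = 2`] -/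
theorem IsSimple.hodgeGroupC_prod_eq_blockDiagProd_of_finrank_centerField_eq_two_of_not_hodgeGroup_comm_of_endAlgRat_ne_bot_of_finrank_eq_three_two
    (hT : IsSimple Ψ₁) (hS : IsSimple Ψ₂) (hη₁ : IsRiemannForm Ψ₁ η₁) (hη₂ : IsRiemannForm Ψ₂ η₂) (h3 : finrank ℂ E₁ = 3)
    (h2 : finrank ℂ E₂ = 2) (he : finrank ℚ (centerField Ψ₁ hT) = 2)
    (hnc : ¬ ∀ M ∈ hodgeGroup Ψ₂, ∀ N ∈ hodgeGroup Ψ₂, M * N = N * M) (hE : endAlgRat Ψ₂ ≠ ⊥) :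
    hodgeGroupC (prodPeriod Ψ₁ Ψ₂) = blockDiagProd (hodgeGroupC Ψ₁) (hodgeGroupC Ψ₂) := by
  haveI := hS.isSemisimple_hodgeGroupLieRat_of_not_hodgeGroup_comm_of_finrank_eq_two hη₂ h2 hnc
  exact hT.hodgeGroupC_prod_eq_blockDiagProd_of_finrank_centerField_eq_two_of_isSemisimple_of_finrank_lt Ψ₂ hη₁ h3 he
    (lt_of_le_of_lt (hS.finrank_hodgeGroupLieRat_le_six_of_endAlgRat_ne_bot_of_finrank_eq_two hη₂ h2 hE) (by norm_num))

/-- **CONDITION (D) FOR `T × S`, `T` OF TYPE IV(1,1), `S` ANY SIMPLE POLARISED SURFACE**: `S` of CM type — ✔ g55-#5 («`U_F` is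
`ℚ`-simple», Lemma (3.6)); `End⁰(S) = ℚ` — ✔ g55-#3 (Hodge-general factor); `S` of type I(2) ∕ II(1) — the splitting above and the
(D)-transfer (`T`, `S` stably nondegenerate). [cite: MoonenZarhin1999LowDim, Thm. (0.2) (4) (p0002 L1–L8), §5 (5.8), (5.10) (p0010 L3–L29), §3 Thm. (3.2) (2)]
[cite: Hazama1983, Lemma (3.1)] -/
theorem IsSimple.forall_divisorClasses_powPeriod_prod_eq_hodgeClasses_of_finrank_centerField_eq_two_of_finrank_eq_three_two
    (hT : IsSimple Ψ₁) (hS : IsSimple Ψ₂) (hη₁ : IsRiemannForm Ψ₁ η₁) (hη₂ : IsRiemannForm Ψ₂ η₂) (h3 : finrank ℂ E₁ = 3)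
    (h2 : finrank ℂ E₂ = 2) (he : finrank ℚ (centerField Ψ₁ hT) = 2) :
    ∀ k p, divisorClasses (powPeriod (prodPeriod Ψ₁ Ψ₂) k) p = hodgeClasses (powPeriod (prodPeriod Ψ₁ Ψ₂) k) p := by
  by_cases hc : ∀ M ∈ hodgeGroup Ψ₂, ∀ N ∈ hodgeGroup Ψ₂, M * N = N * M
  · exact hT.forall_divisorClasses_powPeriod_prod_eq_hodgeClasses_of_finrank_centerField_eq_two_of_hodgeGroup_comm_of_finrank_eq_three_two
      hS hη₁ hη₂ h3 h2 he hc
  by_cases hE : endAlgRat Ψ₂ = ⊥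
  · exact hT.forall_divisorClasses_powPeriod_prod_eq_hodgeClasses_of_endAlgRat_eq_bot_of_finrank_eq_three_two hη₁ hη₂ h3 h2 hE
  · exact forall_divisorClasses_powPeriod_prod_eq_hodgeClasses_of_hodgeGroupC_prod_eq
      (hT.hodgeGroupC_prod_eq_blockDiagProd_of_finrank_centerField_eq_two_of_not_hodgeGroup_comm_of_endAlgRat_ne_bot_of_finrank_eq_three_two
        hS hη₁ hη₂ h3 h2 he hc hE)
      (hη₁.forall_divisorClasses_powPeriod_eq_hodgeClasses_of_finrank_eq_three h3)
      (IsAbelianVariety.forall_divisorClasses_powPeriod_eq_hodgeClasses_of_finrank_eq_two ⟨η₂, hη₂⟩ h2)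

/-- **THE `T × S` DISPATCH WITH THE LAST RESIDUAL: for SIMPLE polarised `T` (threefold) and `S` (surface) NOT BOTH OF CM TYPE,
`ℬ•((T × S)ⁿ) = 𝒟•((T × S)ⁿ)` for all `n`** — centre of `End⁰(T)` totally real: ✔ g55-#3; `[Z(End⁰ T) : ℚ] = 2` (type IV(1,1)):
the previous theorem; `= 6` (type IV(3,1)): `T` is of CM type, so `S` is not, ✔ g55-#3 (perfect × commutative).  NOT covered
(-- TODO(general form)): `T` CM × `S` CM — (5.10) with `Y₂` of CM type, Moonen–Zarhin's Galois-group comparison.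
[cite: MoonenZarhin1999LowDim, Thm. (0.2) (4) (p0002 L1–L8), §5 (5.6)–(5.8), (5.10) (p0009 L122 – p0010 L45), §2 (2.3) `g = 3`]
[cite: Gordon1999HodgeAVSurvey, Thm. 7.5 and 7.6.2] -/
theorem IsSimple.forall_divisorClasses_powPeriod_prod_eq_hodgeClasses_of_finrank_eq_three_two_of_not_and (hT : IsSimple Ψ₁)
    (hS : IsSimple Ψ₂) (hη₁ : IsRiemannForm Ψ₁ η₁) (hη₂ : IsRiemannForm Ψ₂ η₂) (h3 : finrank ℂ E₁ = 3) (h2 : finrank ℂ E₂ = 2)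
    (h : ¬ ((∀ M ∈ hodgeGroup Ψ₁, ∀ N ∈ hodgeGroup Ψ₁, M * N = N * M) ∧ ∀ M ∈ hodgeGroup Ψ₂, ∀ N ∈ hodgeGroup Ψ₂, M * N = N * M)) :
    ∀ k p, divisorClasses (powPeriod (prodPeriod Ψ₁ Ψ₂) k) p = hodgeClasses (powPeriod (prodPeriod Ψ₁ Ψ₂) k) p := by
  rcases hT.finrank_centerField_mem_of_finrank_eq_three hη₁ h3 with ⟨hR, -⟩ | ⟨-, he⟩
  · haveI := hR
    exact hT.forall_divisorClasses_powPeriod_prod_eq_hodgeClasses_of_isTotallyReal_of_finrank_eq_three_two hS hη₁ hη₂ h3 h2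
  · rcases he with he | he
    · exact hT.forall_divisorClasses_powPeriod_prod_eq_hodgeClasses_of_finrank_centerField_eq_two_of_finrank_eq_three_two hS hη₁ hη₂
        h3 h2 he
    · have hc₁ := hT.hodgeGroup_comm_of_finrank_centerField_eq_six_of_finrank_eq_three hη₁ h3 he
      exact hS.forall_divisorClasses_powPeriod_prod_eq_hodgeClasses_of_hodgeGroup_comm_of_not_hodgeGroup_comm_of_finrank_eq_three_two
        hη₁ hη₂ h3 h2 hc₁ fun hc₂ ↦ h ⟨hc₁, hc₂⟩

end ThreefoldTimesSurface

section ThreefoldTimesSurfaceIsogenous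

variable {ι : Type*} [Fintype ι] [DecidableEq ι] {F : Type*} [NormedAddCommGroup F] [NormedSpace ℂ F]
  {Φ : (ι → ℝ) ≃L[ℝ] F}
  {κ₁ κ₂ : Type} [Fintype κ₁] [DecidableEq κ₁] [Nonempty κ₁] [Fintype κ₂] [DecidableEq κ₂] [Nonempty κ₂]
  {E₁ E₂ : Type} [NormedAddCommGroup E₁] [NormedSpace ℂ E₁] [FiniteDimensional ℂ E₁] [NormedAddCommGroup E₂]
  [NormedSpace ℂ E₂] [FiniteDimensional ℂ E₂] {Ψ₁ : (κ₁ → ℝ) ≃L[ℝ] E₁} {Ψ₂ : (κ₂ → ℝ) ≃L[ℝ] E₂}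
  {η₁ : E₁ [⋀^Fin 2]→L[ℝ] ℝ} {η₂ : E₂ [⋀^Fin 2]→L[ℝ] ℝ}

/-- **Every complex torus isogenous to `T × S` (simple, not both CM) satisfies (D).**
[cite: MoonenZarhin1999LowDim, Thm. (0.2) (4) (p0002 L1–L8)] [cite: Lange2023AbelianVarietiesComplex, §1.1.2 Cor. 1.1.16] -/
theorem IsIsogenous.forall_divisorClasses_powPeriod_eq_hodgeClasses_of_prod_of_finrank_eq_three_two_of_not_and
    (hiso : IsIsogenous Φ (prodPeriod Ψ₁ Ψ₂)) (hT : IsSimple Ψ₁) (hS : IsSimple Ψ₂) (hη₁ : IsRiemannForm Ψ₁ η₁)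
    (hη₂ : IsRiemannForm Ψ₂ η₂) (h3 : finrank ℂ E₁ = 3) (h2 : finrank ℂ E₂ = 2)
    (h : ¬ ((∀ M ∈ hodgeGroup Ψ₁, ∀ N ∈ hodgeGroup Ψ₁, M * N = N * M) ∧ ∀ M ∈ hodgeGroup Ψ₂, ∀ N ∈ hodgeGroup Ψ₂, M * N = N * M)) :
    ∀ k p, divisorClasses (powPeriod Φ k) p = hodgeClasses (powPeriod Φ k) p :=
  hiso.forall_powPeriod_divisorClasses_eq_hodgeClasses_iff.2
    (hT.forall_divisorClasses_powPeriod_prod_eq_hodgeClasses_of_finrank_eq_three_two_of_not_and hS hη₁ hη₂ h3 h2 h)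

/-- **«`Hg(X) = Sp_D(V,φ)`» for `X ∼ T × S` (simple, not both CM)** (real points, any polarisation `ω`), from (D) by Gordon's
Thm. 7.5 (1) ⟹ (2). [cite: MoonenZarhin1999LowDim, Thm. (0.2) (4) (p0002 L5–L8)] [cite: Gordon1999HodgeAVSurvey, Thm. 7.5 (1) ⟺ (2)]
[cite: Milne1999LefschetzClasses, §4 Prop. 4.8] -/
theorem IsRiemannForm.hodgeGroup_eq_lefschetzGroup_of_isIsogenous_prod_of_finrank_eq_three_two_of_not_and {ι' : Type} [Fintype ι']
    [DecidableEq ι'] {F' : Type} [NormedAddCommGroup F'] [NormedSpace ℂ F'] [FiniteDimensional ℂ F']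
    {Φ' : (ι' → ℝ) ≃L[ℝ] F'} {ω : F' [⋀^Fin 2]→L[ℝ] ℝ} (hω : IsRiemannForm Φ' ω) (hiso : IsIsogenous Φ' (prodPeriod Ψ₁ Ψ₂))
    (hT : IsSimple Ψ₁) (hS : IsSimple Ψ₂) (hη₁ : IsRiemannForm Ψ₁ η₁) (hη₂ : IsRiemannForm Ψ₂ η₂) (h3 : finrank ℂ E₁ = 3)
    (h2 : finrank ℂ E₂ = 2)
    (h : ¬ ((∀ M ∈ hodgeGroup Ψ₁, ∀ N ∈ hodgeGroup Ψ₁, M * N = N * M) ∧ ∀ M ∈ hodgeGroup Ψ₂, ∀ N ∈ hodgeGroup Ψ₂, M * N = N * M)) :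
    hodgeGroup Φ' = lefschetzGroup Φ' ω := by
  obtain ⟨G, hG⟩ := hω.exists_ratMatrix_latticeGram
  have h0 : 0 < finrank ℂ F' := by
    have hc := hiso.card_eq
    rw [Fintype.card_sum, card_eq_two_mul_finrank Φ', card_eq_two_mul_finrank Ψ₁, h3] at hc
    omega
  exact ((hω.forall_divisorClasses_powPeriod_eq_hodgeClasses_iff_eq_and_hodgeGroup_eq_lefschetzGroup hG h0).1
    (hiso.forall_divisorClasses_powPeriod_eq_hodgeClasses_of_prod_of_finrank_eq_three_two_of_not_and hT hS hη₁ hη₂ h3 h2 h)).2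

end ThreefoldTimesSurfaceIsogenous

end ComplexTorus

end Literature.Geometry.Kaehler
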